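import Summits.ValiantsHypothesis.ValiantsHypothesis.Theorems.KPlusLogSqLawTropicalBSplitGlue
import Summits.ValiantsHypothesis.ValiantsHypothesis.Theorems.KPlusLogSqLawTropicalExchange

/-!
# Route «KPlusLogSqLaw», crux `TropicalB` (stmt-ValiantsHypothesis-19771) — THE RE-ASSEMBLY DEFICIT: a present term carrying the slope
# increments of a set `J` of single-token activations over a common dominant base costs MORE than those activations together; hence no two
# present terms re-assemble `k` activations (every `k`, every distribution)

HONEST FRAMING.  Helper toward the registered stubs `stub_tropThin` / `stub_tropFat` of `Cruxes/TropicalB/Lines/birth.lean` (crux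
`Summit.ValiantsHypothesis.ValiantsHypothesis.Theses.KPlusLogSqLaw.TropicalB`, item stmt-ValiantsHypothesis-19771, route KPlusLogSqLaw;
cell `pub-symmetroid`, seat val-sym-trop-p5 g25, refuter-adjacent lane, 2026-08-29; `--supports … --as helper`).  A STRUCTURE law about
unique optima (`IsDominant`) of an ARBITRARY dominance design; nothing here bounds `TropicalB`, and nothing bears on `WeakLifting`,
DoorA26 / DoorA34, `MatrixDescartes` (stmt-ValiantsHypothesis-18050) or VP ≠ VNP.

THE LAW.  `B` is the unique optimum at `θB`; `P j` (`j : ι`, any finite index type) are unique optima at slopes `θ j` with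
`slope B < slope (P j)` («activations over `B`», increments `δ_j`).  Write `V(X)` for the valuation sum of a term.
* `Deficit.activation_gain_pos` — `V(P j) − V(B) < θ j · δ_j` (the activation beats the base at its own slope).
* `Deficit.reassembly_deficit` — **DEFICIT**: if a PRESENT term `T ∉ {B} ∪ {P j}` has `slope T = slope B + Σ_{j ∈ J} δ_j` for a set `J`
  of indices, then `Σ_{j ∈ J} (V(P j) − V(B)) < V(T) − V(B)`.  (For `J = ∅` this is `B`'s uniqueness at its own slope; otherwise compare
  `T` with the activation `P j*` of LARGEST slope parameter in `J` and bound the other increments by `activation_gain_pos` and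
  `θ l ≤ θ j*`.)  This is the supermodularity of the chain's value function made available for terms that are merely PRESENT.
* `Deficit.no_two_term_reassembly` — **NO TWO-TERM RE-ASSEMBLY OF `k` ACTIVATIONS**: there are no two present terms `T₁, T₂ ∉ {B} ∪ {P j}`
  with `slope T₁ = slope B + Σ_{J} δ_j`, `slope T₂ = slope B + Σ_{Jᶜ} δ_j` and `V(T₁) + V(T₂) + (|ι| − 2)·V(B) = Σ_j V(P j)` — for EVERY
  number of activations and every distribution `J`.  `|ι| = 2` is the value half of the parallel-contact law (`…TropicalBParallelContact`),
  `|ι| = 3` is `ThreeBody.three_body_activation` (`…TropicalBThreeBodyActivation`, proved there by eight explicit certificates); the general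
  case is what the junction «hop identity» needs for coupling cycles of ANY length (memo HOME/val-sym-trop-p5/g25/CONTACT-LAWS-g25.md §1):
  `k` single-token activation cycles over a common state whose pairwise contacts form a free `k`-gon re-assemble, by the docking lemma
  (`Docking.docking`, `…TropicalBDockingLaw`, `dock` = a `k`-cycle and its inverse), into two present terms with exactly this bookkeeping.

[folklore ingredients (lower hulls, affine gains); the packaging is the cell's, no citation exists]
-/

set_option linter.dupNamespace false
set_option autoImplicit false

namespace Summit.ValiantsHypothesis.ValiantsHypothesis.Theorems.KPlusLogSqLaw

namespace Deficit

open Summit.ValiantsHypothesis.ValiantsHypothesis.Theorems.MatrixDescartes.Negative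
open Summit.ValiantsHypothesis.ValiantsHypothesis.Theorems.LacunarySymmetroidMatrixDescartes
open Finset
open scoped BigOperators

variable {m K : ℕ} {ι : Type*} [Fintype ι] [DecidableEq ι]
  (d : Fin K → ℕ) (v ε : Fin m → Fin m → Fin K → ℤ)
  {θB : ℤ} (θ : ι → ℤ) {B : Equiv.Perm (Fin m) × (Fin m → Fin K)} (P : ι → Equiv.Perm (Fin m) × (Fin m → Fin K))

omit [Fintype ι] [DecidableEq ι] in
/-- **An activation beats the base at its own slope**: `V(P j) − V(B) < θ j · (slope (P j) − slope B)`. [folklore] -/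
theorem activation_gain_pos (hB : termSign ε B ≠ 0) (hP : ∀ j, IsDominant d v ε (θ j) (P j))
    (hδ : ∀ j, TropicalCensus.slope d B < TropicalCensus.slope d (P j)) (j : ι) :
    (∑ i, v ((P j).1 i) i ((P j).2 i)) - (∑ i, v (B.1 i) i (B.2 i)) <
      θ j * (TropicalCensus.slope d (P j) - TropicalCensus.slope d B) := by
  have hne : B ≠ P j := fun h => by have := hδ j; rw [h] at this; exact lt_irrefl _ this
  have h := (hP j).2 B hne hB
  rw [TropicalCensus.tropWeight_eq_slope_sub, TropicalCensus.tropWeight_eq_slope_sub] at h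
  linarith [(by ring : θ j * (TropicalCensus.slope d (P j) - TropicalCensus.slope d B)
    = θ j * TropicalCensus.slope d (P j) - θ j * TropicalCensus.slope d B)]

omit [Fintype ι] in
/-- **RE-ASSEMBLY DEFICIT.**  If `B` is the unique optimum at `θB`, the `P j` unique optima at `θ j` with `slope B < slope (P j)`, and a
present term `T ∉ {B} ∪ {P j}` has `slope T = slope B + Σ_{j ∈ J} (slope (P j) − slope B)`, then
`Σ_{j ∈ J} (V(P j) − V(B)) < V(T) − V(B)`. [this cell; folklore ingredients] -/
theorem reassembly_deficit (hB : IsDominant d v ε θB B) (hP : ∀ j, IsDominant d v ε (θ j) (P j))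
    (hδ : ∀ j, TropicalCensus.slope d B < TropicalCensus.slope d (P j))
    {T : Equiv.Perm (Fin m) × (Fin m → Fin K)} (hT : termSign ε T ≠ 0) (hTB : T ≠ B) (hTP : ∀ j, T ≠ P j)
    (J : Finset ι)
    (hs : TropicalCensus.slope d T = TropicalCensus.slope d B + ∑ j ∈ J, (TropicalCensus.slope d (P j) - TropicalCensus.slope d B)) :
    ∑ j ∈ J, ((∑ i, v ((P j).1 i) i ((P j).2 i)) - ∑ i, v (B.1 i) i (B.2 i)) <
      (∑ i, v (T.1 i) i (T.2 i)) - ∑ i, v (B.1 i) i (B.2 i) := by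
  rcases J.eq_empty_or_nonempty with hJ | hJ
  · -- tokenless: `B` is the unique optimum at its own slope
    subst hJ
    rw [sum_empty] at hs ⊢
    have h := hB.2 T hTB hT
    rw [TropicalCensus.tropWeight_eq_slope_sub, TropicalCensus.tropWeight_eq_slope_sub, hs, add_zero] at h
    linarith
  · -- compare with the activation of largest slope parameter in `J`
    obtain ⟨js, hjs, hmax⟩ := exists_max_image J θ hJ
    have h := (hP js).2 T (hTP js) hT
    rw [TropicalCensus.tropWeight_eq_slope_sub, TropicalCensus.tropWeight_eq_slope_sub, hs] at h
    -- the other increments: `V(P l) − V(B) < θ l · δ_l ≤ θ js · δ_l`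
    have hother : ∀ l ∈ J.erase js,
        (∑ i, v ((P l).1 i) i ((P l).2 i)) - (∑ i, v (B.1 i) i (B.2 i)) ≤
          θ js * (TropicalCensus.slope d (P l) - TropicalCensus.slope d B) := by
      intro l hl
      have h1 := activation_gain_pos d v ε θ P hB.1 hP hδ l
      have h2 : θ l * (TropicalCensus.slope d (P l) - TropicalCensus.slope d B) ≤
          θ js * (TropicalCensus.slope d (P l) - TropicalCensus.slope d B) :=
        mul_le_mul_of_nonneg_right (hmax l (mem_of_mem_erase hl)) (by linarith [hδ l])
      linarith
    have hsum := sum_le_sum hother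
    rw [← mul_sum] at hsum
    -- split the sums at `js`
    have e1 := add_sum_erase J (fun j => (∑ i, v ((P j).1 i) i ((P j).2 i)) - ∑ i, v (B.1 i) i (B.2 i)) hjs
    have e2 := add_sum_erase J (fun j => TropicalCensus.slope d (P j) - TropicalCensus.slope d B) hjs
    rw [← e2] at h
    rw [← e1]
    have hring : θ js * (TropicalCensus.slope d B + (TropicalCensus.slope d (P js) - TropicalCensus.slope d B +
        ∑ x ∈ J.erase js, (TropicalCensus.slope d (P x) - TropicalCensus.slope d B))) =
        θ js * TropicalCensus.slope d (P js) +
          θ js * ∑ x ∈ J.erase js, (TropicalCensus.slope d (P x) - TropicalCensus.slope d B) := by ring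
    rw [hring] at h
    linarith

/-- **NO TWO-TERM RE-ASSEMBLY OF `k` ACTIVATIONS** (every `k = |ι|`, every distribution `J`): two present terms `T₁, T₂ ∉ {B} ∪ {P j}`
carrying the increments of `J` and of `Jᶜ` have `Σ_j V(P j) + 2·V(B) < V(T₁) + V(T₂) + |ι|·V(B)`; in particular the cell-multiset
identity `V(T₁) + V(T₂) + (|ι| − 2)·V(B) = Σ_j V(P j)` of a free `k`-gon recombination is impossible. [this cell] -/
theorem no_two_term_reassembly (hB : IsDominant d v ε θB B) (hP : ∀ j, IsDominant d v ε (θ j) (P j))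
    (hδ : ∀ j, TropicalCensus.slope d B < TropicalCensus.slope d (P j))
    {T₁ T₂ : Equiv.Perm (Fin m) × (Fin m → Fin K)} (hT₁ : termSign ε T₁ ≠ 0) (hT₂ : termSign ε T₂ ≠ 0)
    (h₁B : T₁ ≠ B) (h₂B : T₂ ≠ B) (h₁P : ∀ j, T₁ ≠ P j) (h₂P : ∀ j, T₂ ≠ P j) (J : Finset ι)
    (hs₁ : TropicalCensus.slope d T₁ = TropicalCensus.slope d B + ∑ j ∈ J, (TropicalCensus.slope d (P j) - TropicalCensus.slope d B))
    (hs₂ : TropicalCensus.slope d T₂ = TropicalCensus.slope d B + ∑ j ∈ Jᶜ, (TropicalCensus.slope d (P j) - TropicalCensus.slope d B)) :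
    (∑ j, ∑ i, v ((P j).1 i) i ((P j).2 i)) + 2 * ∑ i, v (B.1 i) i (B.2 i) <
      (∑ i, v (T₁.1 i) i (T₁.2 i)) + (∑ i, v (T₂.1 i) i (T₂.2 i)) + (Fintype.card ι : ℤ) * ∑ i, v (B.1 i) i (B.2 i) := by
  have d₁ := reassembly_deficit d v ε θ P hB hP hδ hT₁ h₁B h₁P J hs₁
  have d₂ := reassembly_deficit d v ε θ P hB hP hδ hT₂ h₂B h₂P Jᶜ hs₂
  have hsplit := sum_add_sum_compl J fun j => (∑ i, v ((P j).1 i) i ((P j).2 i)) - ∑ i, v (B.1 i) i (B.2 i)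
  have htot : ∑ j, ((∑ i, v ((P j).1 i) i ((P j).2 i)) - ∑ i, v (B.1 i) i (B.2 i)) =
      (∑ j, ∑ i, v ((P j).1 i) i ((P j).2 i)) - (Fintype.card ι : ℤ) * ∑ i, v (B.1 i) i (B.2 i) := by
    rw [sum_sub_distrib, sum_const, card_univ, nsmul_eq_mul]
  linarith

/-- **NO MULTI-TERM RE-ASSEMBLY** (every number of activations, every number of pieces; appended 2026-08-29, same seat): if present terms
`T a` (`a : α`, a nonempty finite index type), none equal to `B` or to a `P j`, carry the slope increments of the parts `J a` of a PARTITION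
of the index set (`slope (T a) = slope B + Σ_{j ∈ J a} δ_j`, the `J a` pairwise disjoint with union everything), then
`Σ_j (V(P j) − V(B)) < Σ_a (V(T a) − V(B))`; in particular the cell-multiset identity `Σ_a V(T a) = Σ_j V(P j) + (|α| − |ι|)·V(B)` of a
decomposition of the `k` activation cycles into `r` dockings (memo CONTACT-LAWS-g25.md §2: bigon decompositions of a reversed common stretch,
the 3-piece decomposition of the `k = 5` shift-2 contact, …) is impossible.  Sum of `reassembly_deficit` over the pieces. [this cell] -/
theorem no_multi_reassembly {α : Type*} [Fintype α] [Nonempty α] (hB : IsDominant d v ε θB B)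
    (hP : ∀ j, IsDominant d v ε (θ j) (P j)) (hδ : ∀ j, TropicalCensus.slope d B < TropicalCensus.slope d (P j))
    (T : α → Equiv.Perm (Fin m) × (Fin m → Fin K)) (hT : ∀ a, termSign ε (T a) ≠ 0) (hTB : ∀ a, T a ≠ B)
    (hTP : ∀ a j, T a ≠ P j) (J : α → Finset ι) (hJ : ∀ a b, a ≠ b → Disjoint (J a) (J b))
    (hcover : ∀ j, ∃ a, j ∈ J a)
    (hs : ∀ a, TropicalCensus.slope d (T a) =
      TropicalCensus.slope d B + ∑ j ∈ J a, (TropicalCensus.slope d (P j) - TropicalCensus.slope d B)) :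
    ∑ j, ((∑ i, v ((P j).1 i) i ((P j).2 i)) - ∑ i, v (B.1 i) i (B.2 i)) <
      ∑ a, ((∑ i, v ((T a).1 i) i ((T a).2 i)) - ∑ i, v (B.1 i) i (B.2 i)) := by
  classical
  -- each piece is in deficit
  have hlt : ∀ a ∈ (univ : Finset α), ∑ j ∈ J a, ((∑ i, v ((P j).1 i) i ((P j).2 i)) - ∑ i, v (B.1 i) i (B.2 i)) <
      (∑ i, v ((T a).1 i) i ((T a).2 i)) - ∑ i, v (B.1 i) i (B.2 i) :=
    fun a _ => reassembly_deficit d v ε θ P hB hP hδ (hT a) (hTB a) (hTP a) (J a) (hs a)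
  have hsum := sum_lt_sum_of_nonempty univ_nonempty hlt
  -- the parts partition the index set
  have hpart : ∑ a, ∑ j ∈ J a, ((∑ i, v ((P j).1 i) i ((P j).2 i)) - ∑ i, v (B.1 i) i (B.2 i)) =
      ∑ j, ((∑ i, v ((P j).1 i) i ((P j).2 i)) - ∑ i, v (B.1 i) i (B.2 i)) := by
    rw [← sum_biUnion (fun a _ b _ hab => hJ a b hab)]
    refine sum_congr ?_ fun _ _ => rfl
    ext j
    simp only [mem_biUnion, mem_univ, true_and, iff_true]
    exact hcover j
  rw [hpart] at hsum
  exact hsum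

end Deficit

end Summit.ValiantsHypothesis.ValiantsHypothesis.Theorems.KPlusLogSqLaw
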